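import Literature.Geometry.Lorentzian.KillingFlowIsometry
import Literature.Geometry.Manifold.FlowBoxFlow
import HarnessLib

/-!
# `[V, W] = 0` near an orbit segment of `V` makes `W` invariant under the flow of `V` along it

Local form of Lee's Thm. 9.42 (*Introduction to Smooth Manifolds*, 2nd ed., 2012: "`W` is invariant
under the flow of `V` iff `[V, W] = 0`"), companion of the GLOBAL statements
`eventually_mfderiv_flow_apply_eq_of_ne_zero` / `mfderiv_flow_apply_eq_of_ne_zero` /
`mfderiv_flow_apply_eq` of `KillingAlgebraAsymptoticallyFlatProofs.lean`, which ask `W` to be `C^∞`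
and `[V, W] = 0` on the WHOLE manifold.  In the black-hole literature the second field is typically
known only on an open set — a Killing field "defined near `𝓔⁺`" (Chruściel–Costa 2008, §4.1,
Thm. 4.14) commuting there with the stationary Killing field `X`, whose flow `φₜ[X]` is global
(§2.2) — and one needs `φₜ[X]_* W = W` along the pieces of `X`-orbits that stay in that set.  For a
`C^∞` field `V` on a Hausdorff manifold modelled on a complete normed space `E` (`𝓘(ℝ, E)`, e.g.
`𝓡 4`) with a flow `θ` given as data (`θ(0, ·) = id`, `t ↦ θ(t, p)` integral curves of `V`; for the
segment statement also `C²` with the group law) we prove: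

* `eventually_mfderiv_flow_apply_eq_of_eventually` — **local invariance at a regular point**: if
  `W` is `C^∞` near `p`, `[V, W] = 0` near `p` and `V p ≠ 0`, then `dθₜ(W p) = W(θₜ p)` for all small
  `t` (flow box of `V` about `p`, `Literature.Geometry.Manifold.exists_flowBox_flow_eq`; naturality of
  the bracket, Mathlib's `VectorField.mpullback_mlieBracket`, turns `[V, W] = 0` into
  `DŴ · v = 0` for the chart representative `Ŵ`, which is therefore constant along the short straight
  segment representing the orbit — the printed proof of Lee's Thm. 9.42, localised);
* `mfderiv_flow_apply_eq_of_forall_mem` — **invariance along an orbit piece inside the good set**: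
  if `W` is `C^∞` with `[V, W] = 0` on an open set `𝒪`, `V p ≠ 0`, and `θ(s, p) ∈ 𝒪` for all `s` in
  a preconnected set of times `J ∋ 0`, then `dθₜ(W p) = W(θₜ p)` for every `t ∈ J` (the set of good
  times in `J` is relatively closed — two continuous curves in the Hausdorff `TM` — and relatively
  open — group law `θₜ = θ_{t−t₀} ∘ θ_{t₀}` and the local statement at `θ_{t₀} p ∈ 𝒪`, a regular
  point of `V`);
* `mfderiv_flow_apply_eq_of_forall_uIcc_mem` — the segment form `J = [[0, t]]`.

Everything is proved; no definitions, no named facts.  Not here: zeros of `V` (at an interior zero the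
flow is the identity near `p`; the boundary case needs the density argument of
`mfderiv_flow_apply_eq`); the transported field `(θ₋ₜ)^* W = (θₜ)_* W` and its brackets
(`FlowTransportedField.lean`); the consequences for Killing fields (`KillingFieldOnNaturality.lean`
transports `IsKillingFieldOn` under the isometries `θₜ`).

## References

* J. M. Lee, *Introduction to Smooth Manifolds*, 2nd ed., GTM 218, Springer 2012, Thm. 9.22,
  Thm. 9.42. (key `LeeSmoothManifolds2013`)
* P. T. Chruściel, J. L. Costa, Astérisque 321 (2008) 195–265 = arXiv:0806.0016, §2.2, §4.1.
  (key `ChruscielCosta2008`)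
-/

noncomputable section

open Bundle Set Function Filter VectorField
open scoped Manifold ContDiff Topology

namespace Literature.Geometry.Lorentzian

variable {E : Type*} [NormedAddCommGroup E] [NormedSpace ℝ E] [CompleteSpace E]
  {M : Type*} [TopologicalSpace M] [ChartedSpace E M] [IsManifold 𝓘(ℝ, E) ∞ M] [T2Space M]
  {V W : Π x : M, TangentSpace 𝓘(ℝ, E) x} {θ : ℝ × M → M}

/-! ### Local invariance at a regular point -/

/-- **Local invariance at a regular point, local hypotheses** (Lee 2012, Thm. 9.42, direction
`[V, W] = 0 ⇒ W` is invariant under the flow of `V`): let `V` be a `C^∞` field with flow `θ`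
(`θ(0, ·) = id`, `t ↦ θ(t, p)` integral curves), and let `W` be `C^∞` near `p` with `[V, W] = 0` near
`p`, where `V p ≠ 0`. Then `dθₜ (W p) = W (θₜ p)` for all small `t`.  Proof: in a flow box `ψ` of `V`
about `p` (`exists_flowBox_flow_eq`) the field `V` is a constant `v` and `θₜ = ψ⁻¹ (ψ · + t v)`; by
naturality of the bracket (`mpullback_mlieBracket`) the chart representative `Ŵ = (ψ⁻¹)^* W` satisfies
`DŴ · v = [v, Ŵ] = 0` at the chart images of the points where the hypotheses hold, hence is constant
along the segment `ψ p + s v` for small `|s|`, which is the claim read in the chart.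
[cite: LeeSmoothManifolds2013, Thm. 9.42] -/
theorem eventually_mfderiv_flow_apply_eq_of_eventually
    (hV : ContMDiff 𝓘(ℝ, E) 𝓘(ℝ, E).tangent ∞ (fun x ↦ (⟨x, V x⟩ : TangentBundle 𝓘(ℝ, E) M)))
    {p : M}
    (hW : ∀ᶠ x in 𝓝 p,
      ContMDiffAt 𝓘(ℝ, E) 𝓘(ℝ, E).tangent ∞ (fun x ↦ (⟨x, W x⟩ : TangentBundle 𝓘(ℝ, E) M)) x)
    (hVW : ∀ᶠ x in 𝓝 p, mlieBracket 𝓘(ℝ, E) V W x = 0)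
    (hθV : ∀ p, IsMIntegralCurve (fun t ↦ θ (t, p)) V) (hθ0 : ∀ p, θ (0, p) = p)
    (hp : V p ≠ 0) :
    ∀ᶠ t in 𝓝 (0 : ℝ),
      mfderiv 𝓘(ℝ, E) 𝓘(ℝ, E) (fun q ↦ θ (t, q)) p (W p) = W (θ (t, p)) := by
  -- an open set `O ∋ p` on which `W` is smooth and `[V, W] = 0`
  obtain ⟨O, hOsub, hOo, hpO⟩ := _root_.eventually_nhds_iff.1 (hW.and hVW)
  obtain ⟨ψ, hψ, hpψ, hψV, hψv, ε, hε, N, hNo, hpN, hNψ, hbox⟩ :=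
    Literature.Geometry.Manifold.exists_flowBox_flow_eq hV hθV hθ0 hp
  set v : E := (show E from V p) with hv_def
  -- smoothness of `ψ`, `ψ⁻¹` and the mutual inverse differentials
  have hψt : ∀ q ∈ ψ.target, ContMDiffAt 𝓘(ℝ, E) 𝓘(ℝ, E) ∞ ψ.symm q := fun q hq ↦
    (contMDiffOn_symm_of_mem_maximalAtlas hψ).contMDiffAt (ψ.open_target.mem_nhds hq)
  have hψd : ψ.MDifferentiable 𝓘(ℝ, E) 𝓘(ℝ, E) :=
    ⟨(contMDiffOn_of_mem_maximalAtlas hψ).mdifferentiableOn (by simp),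
      (contMDiffOn_symm_of_mem_maximalAtlas hψ).mdifferentiableOn (by simp)⟩
  have hinv : ∀ x ∈ ψ.source,
      (mfderiv 𝓘(ℝ, E) 𝓘(ℝ, E) ψ.symm (ψ x)).inverse = mfderiv 𝓘(ℝ, E) 𝓘(ℝ, E) ψ x := by
    intro x hx
    refine ContinuousLinearMap.inverse_eq (hψd.symm_comp_deriv hx) ?_
    have h := hψd.comp_symm_deriv (ψ.map_source hx)
    rwa [ψ.left_inv hx] at h
  have hInv : ∀ q ∈ ψ.target, (mfderiv 𝓘(ℝ, E) 𝓘(ℝ, E) ψ.symm q).IsInvertible := by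
    intro q hq
    refine ContinuousLinearMap.IsInvertible.of_inverse
      (g := mfderiv 𝓘(ℝ, E) 𝓘(ℝ, E) ψ (ψ.symm q)) ?_ (hψd.comp_symm_deriv hq)
    have h := hψd.symm_comp_deriv (ψ.map_target hq)
    rwa [ψ.right_inv hq] at h
  -- the chart representatives: `V̂ ≡ v`, `Ŵ = (ψ⁻¹)^* W`
  have hVhat : ∀ q ∈ ψ.target, mpullback 𝓘(ℝ, E) 𝓘(ℝ, E) ψ.symm V q = v := by
    intro q hq
    have hx : ψ.symm q ∈ ψ.source := ψ.map_target hq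
    have h1 := hinv (ψ.symm q) hx
    rw [ψ.right_inv hq] at h1
    rw [mpullback_apply, h1]
    exact hψV (ψ.symm q) hx
  set What : E → E := fun q ↦ mpullback 𝓘(ℝ, E) 𝓘(ℝ, E) ψ.symm W q with hWhat_def
  have hWhat : ∀ x ∈ ψ.source, What (ψ x) = mfderiv 𝓘(ℝ, E) 𝓘(ℝ, E) ψ x (W x) := by
    intro x hx
    simp only [hWhat_def, mpullback_apply]
    rw [hinv x hx, ψ.left_inv hx]
  -- the good part of the chart target: images of points of `O`
  set Tg : Set E := ψ.target ∩ ψ.symm ⁻¹' O with hTg_def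
  have hTgo : IsOpen Tg := ψ.continuousOn_symm.isOpen_inter_preimage ψ.open_target hOo
  have hpTg : ψ p ∈ Tg := ⟨ψ.map_source hpψ, by
    show ψ.symm (ψ p) ∈ O
    rw [ψ.left_inv hpψ]; exact hpO⟩
  have hWhat_smooth : ∀ q ∈ Tg, ContDiffAt ℝ 1 What q := by
    intro q hq
    have h := ContMDiffAt.mpullback_vectorField_preimage (I := 𝓘(ℝ, E)) (I' := 𝓘(ℝ, E))
      (m := 1) (n := ∞) (((hOsub _ hq.2).1).of_le (by exact_mod_cast le_top)) (hψt q hq.1)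
      (hInv q hq.1) (WithTop.coe_le_coe.2 le_top)
    exact contMDiffAt_vectorSpace_iff_contDiffAt.1 h
  -- `[V, W] = 0` read in the box: `DŴ · v = 0` on the good part of the target
  haveI : IsManifold 𝓘(ℝ, E) (minSmoothness ℝ 2) M := by
    rw [minSmoothness_of_isRCLikeNormedField]
    infer_instance
  have hbr : ∀ q ∈ Tg, fderiv ℝ What q v = 0 := by
    intro q hq
    have hWq : MDiffAt (T% W) (ψ.symm q) := ((hOsub _ hq.2).1).mdifferentiableAt (by simp)
    have key := mpullback_mlieBracket (I := 𝓘(ℝ, E)) (I' := 𝓘(ℝ, E)) (f := ψ.symm) (V := V)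
      (W := W) (x₀ := q) ((hV _).mdifferentiableAt (by simp)) hWq (hψt q hq.1) (by
        rw [minSmoothness_of_isRCLikeNormedField]
        exact (ENat.LEInfty.out : (2 : ℕ∞ω) ≤ ∞))
    rw [mpullback_apply, (hOsub _ hq.2).2, map_zero, ← mlieBracketWithin_univ,
      mlieBracketWithin_eq_lieBracketWithin, lieBracketWithin_univ] at key
    have hV' : (fun q ↦ mpullback 𝓘(ℝ, E) 𝓘(ℝ, E) ψ.symm V q) =ᶠ[𝓝 q] fun _ ↦ v := by
      filter_upwards [ψ.open_target.mem_nhds hq.1] with q' hq' using hVhat q' hq'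
    rw [hV'.lieBracket_vectorField_eq EventuallyEq.rfl] at key
    simp only [lieBracket, fderiv_fun_const, Pi.zero_apply, zero_apply, sub_zero] at key
    exact key.symm
  -- a time `ε' ≤ ε` for which the segment `ψ p + s v`, `|s| < ε'`, stays in the good part
  obtain ⟨δ, hδ, hδseg⟩ : ∃ δ > (0 : ℝ), ∀ s ∈ Ioo (-δ) δ, ψ p + s • v ∈ Tg := by
    have hc : Continuous fun s : ℝ ↦ ψ p + s • v := by fun_prop
    have ho : IsOpen ((fun s : ℝ ↦ ψ p + s • v) ⁻¹' Tg) := hTgo.preimage hc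
    have h0 : (0 : ℝ) ∈ (fun s : ℝ ↦ ψ p + s • v) ⁻¹' Tg := by simpa using hpTg
    obtain ⟨δ, hδ, hball⟩ := Metric.isOpen_iff.1 ho 0 h0
    refine ⟨δ, hδ, fun s hs ↦ hball ?_⟩
    rw [Metric.mem_ball, dist_zero_right, Real.norm_eq_abs, abs_lt]
    exact hs
  set ε' : ℝ := min ε δ with hε'_def
  have hε' : 0 < ε' := lt_min hε hδ
  have hseg : ∀ s ∈ Ioo (-ε') ε', ψ p + s • v ∈ Tg := fun s hs ↦
    hδseg s ⟨by
      have := min_le_right ε δ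
      linarith [hs.1], hs.2.trans_le (min_le_right ε δ)⟩
  -- translation invariance of `Ŵ` along the segment `ψ p + s v`, `|s| < ε'`
  have hderiv : ∀ s ∈ Ioo (-ε') ε', HasDerivAt (fun s : ℝ ↦ What (ψ p + s • v)) (0 : E) s := by
    intro s hs
    have h1 : HasDerivAt (fun s : ℝ ↦ ψ p + s • v) v s := by
      simpa using ((hasDerivAt_id s).smul_const v).const_add (ψ p)
    have h2 : HasFDerivAt What (fderiv ℝ What (ψ p + s • v)) (ψ p + s • v) :=
      ((hWhat_smooth _ (hseg s hs)).differentiableAt one_ne_zero).hasFDerivAt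
    have h3 := h2.comp_hasDerivAt s h1
    rwa [hbr _ (hseg s hs)] at h3
  have hconst : ∀ s ∈ Ioo (-ε') ε', What (ψ p + s • v) = What (ψ p) := by
    intro s hs
    have h0 : (0 : ℝ) ∈ Ioo (-ε') ε' := ⟨by linarith, hε'⟩
    have key := (convex_Ioo (-ε') ε').is_const_of_fderivWithin_eq_zero (𝕜 := ℝ)
      (f := fun s : ℝ ↦ What (ψ p + s • v))
      (fun s hs ↦ (hderiv s hs).differentiableAt.differentiableWithinAt)
      (fun s hs ↦ by
        rw [fderivWithin_of_isOpen isOpen_Ioo hs, (hderiv s hs).hasFDerivAt.fderiv]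
        ext
        simp) hs h0
    simpa using key
  -- conclusion, for `|t| < ε'`
  filter_upwards [Ioo_mem_nhds (neg_lt_zero.2 hε') hε'] with t ht'
  have ht : t ∈ Ioo (-ε) ε :=
    ⟨lt_of_le_of_lt (neg_le_neg (min_le_left ε δ)) ht'.1, ht'.2.trans_le (min_le_left ε δ)⟩
  obtain ⟨hq, -, hθeq, -⟩ := hbox p hpN t ht
  have hev : (fun q ↦ θ (t, q)) =ᶠ[𝓝 p] fun q ↦ ψ.symm (ψ q + t • v) := by
    filter_upwards [hNo.mem_nhds hpN] with x hx using (hbox x hx t ht).2.2.1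
  rw [hev.mfderiv_eq]
  have h1 : HasMFDerivAt 𝓘(ℝ, E) 𝓘(ℝ, E) ψ p (mfderiv 𝓘(ℝ, E) 𝓘(ℝ, E) ψ p) :=
    (hψd.mdifferentiableAt hpψ).hasMFDerivAt
  have h2 : HasMFDerivAt 𝓘(ℝ, E) 𝓘(ℝ, E) (fun q : E ↦ q + t • v) (ψ p)
      (ContinuousLinearMap.id ℝ (TangentSpace 𝓘(ℝ, E) (ψ p))) :=
    hasMFDerivAt_iff_hasFDerivAt.2 ((hasFDerivAt_id _).add_const _)
  have h3 : HasMFDerivAt 𝓘(ℝ, E) 𝓘(ℝ, E) ψ.symm (ψ p + t • v)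
      (mfderiv 𝓘(ℝ, E) 𝓘(ℝ, E) ψ.symm (ψ p + t • v)) :=
    (hψd.mdifferentiableAt_symm hq).hasMFDerivAt
  have hcomp : HasMFDerivAt 𝓘(ℝ, E) 𝓘(ℝ, E) (fun q ↦ ψ.symm (ψ q + t • v)) p
      ((mfderiv 𝓘(ℝ, E) 𝓘(ℝ, E) ψ.symm (ψ p + t • v)).comp
        ((ContinuousLinearMap.id ℝ (TangentSpace 𝓘(ℝ, E) (ψ p))).comp
          (mfderiv 𝓘(ℝ, E) 𝓘(ℝ, E) ψ p))) :=
    h3.comp p (h2.comp p h1)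
  rw [hcomp.mfderiv]
  change mfderiv 𝓘(ℝ, E) 𝓘(ℝ, E) ψ.symm (ψ p + t • v) (mfderiv 𝓘(ℝ, E) 𝓘(ℝ, E) ψ p (W p)) =
    W (θ (t, p))
  rw [← hWhat p hpψ, ← hconst t ht', hθeq]
  simp only [hWhat_def, mpullback_apply]
  have h := ContinuousLinearMap.ext_iff.1 (hInv _ hq).self_comp_inverse
    (W (ψ.symm (ψ p + t • v)))
  simpa using h

/-! ### Invariance along an orbit piece inside the good set -/

/-- **`W` is invariant under the flow of `V` along an orbit piece on which `[V, W] = 0`** (Lee 2012,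
Thm. 9.42, localised): let `V` be `C^∞` with a `C²` flow `θ` satisfying the group law, `W` be `C^∞`
with `[V, W] = 0` on an open set `𝒪`, `V p ≠ 0`, and let `J ∋ 0` be a preconnected set of times with
`θ(s, p) ∈ 𝒪` for all `s ∈ J`. Then `dθₜ (W p) = W (θₜ p)` for every `t ∈ J`.  The set of good times in
`J` is non-empty (`t = 0`), relatively closed (both sides are continuous curves in the Hausdorff `TM`
as long as the orbit stays in `𝒪`) and relatively open: near a good time `t₀`,
`θₜ = θ_{t − t₀} ∘ θ_{t₀}` and the local statement `eventually_mfderiv_flow_apply_eq_of_eventually`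
applies at `θ_{t₀} p ∈ 𝒪`, where `V ≠ 0` (a field has no zero on a non-trivial orbit).
[cite: LeeSmoothManifolds2013, Thm. 9.42] -/
theorem mfderiv_flow_apply_eq_of_forall_mem
    (hV : ContMDiff 𝓘(ℝ, E) 𝓘(ℝ, E).tangent ∞ (fun x ↦ (⟨x, V x⟩ : TangentBundle 𝓘(ℝ, E) M)))
    {𝒪 : Set M} (h𝒪 : IsOpen 𝒪)
    (hW : ∀ x ∈ 𝒪,
      ContMDiffAt 𝓘(ℝ, E) 𝓘(ℝ, E).tangent ∞ (fun x ↦ (⟨x, W x⟩ : TangentBundle 𝓘(ℝ, E) M)) x)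
    (hVW : ∀ x ∈ 𝒪, mlieBracket 𝓘(ℝ, E) V W x = 0)
    (hθ : ContMDiff (𝓘(ℝ, ℝ).prod 𝓘(ℝ, E)) 𝓘(ℝ, E) 2 θ)
    (hθV : ∀ p, IsMIntegralCurve (fun t ↦ θ (t, p)) V) (hθ0 : ∀ p, θ (0, p) = p)
    (hθadd : ∀ t s p, θ (t, θ (s, p)) = θ (t + s, p)) {p : M} (hp : V p ≠ 0)
    {J : Set ℝ} (hJ : IsPreconnected J) (h0J : (0 : ℝ) ∈ J) (hJ𝒪 : ∀ s ∈ J, θ (s, p) ∈ 𝒪)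
    {t : ℝ} (htJ : t ∈ J) :
    mfderiv 𝓘(ℝ, E) 𝓘(ℝ, E) (fun q ↦ θ (t, q)) p (W p) = W (θ (t, p)) := by
  have hV1 : ContMDiff 𝓘(ℝ, E) 𝓘(ℝ, E).tangent 1
      (fun x ↦ (⟨x, V x⟩ : TangentBundle 𝓘(ℝ, E) M)) := hV.of_le (by exact_mod_cast le_top)
  haveI : T2Space (TangentBundle 𝓘(ℝ, E) M) := t2Space_totalSpace
  haveI : PreconnectedSpace J := Subtype.preconnectedSpace hJ
  -- the set of good times, as a subset of the subtype `J`
  set S : Set J :=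
    {s | mfderiv 𝓘(ℝ, E) 𝓘(ℝ, E) (fun q ↦ θ (s.1, q)) p (W p) = W (θ (s.1, p))} with hS
  suffices h : S = univ by
    have ht : (⟨t, htJ⟩ : J) ∈ S := h ▸ mem_univ _
    exact ht
  refine IsClopen.eq_univ ⟨?_, ?_⟩ ⟨⟨0, h0J⟩, ?_⟩
  · -- relatively closed: equaliser of two continuous curves `J → TM`
    have hF : Continuous fun s : J ↦
        (TotalSpace.mk' E (θ (s.1, p)) (mfderiv 𝓘(ℝ, E) 𝓘(ℝ, E) (fun q ↦ θ (s.1, q)) p (W p)) :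
          TangentBundle 𝓘(ℝ, E) M) :=
      (PseudoRiemannianMetric.continuous_lift_mfderiv_flow hθ p (W p)).comp continuous_subtype_val
    have hG : Continuous fun s : J ↦
        (TotalSpace.mk' E (θ (s.1, p)) (W (θ (s.1, p))) : TangentBundle 𝓘(ℝ, E) M) := by
      refine continuous_iff_continuousAt.2 fun s ↦ ?_
      have hWc : ContinuousAt (fun x ↦ (⟨x, W x⟩ : TangentBundle 𝓘(ℝ, E) M)) (θ (s.1, p)) :=
        (hW _ (hJ𝒪 s.1 s.2)).continuousAt
      have hθc : ContinuousAt (fun s : J ↦ θ (s.1, p)) s :=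
        (hθ.continuous.comp (continuous_subtype_val.prodMk continuous_const)).continuousAt
      exact ContinuousAt.comp (f := fun s : J ↦ θ (s.1, p)) (x := s) hWc hθc
    have hcl := isClosed_eq hF hG
    convert hcl using 1
    ext s
    simp only [hS, mem_setOf_eq, TotalSpace.mk_inj]
  · -- relatively open: propagate from a good time `t₀` by the local statement at `θ (t₀, p)`
    rw [isOpen_iff_mem_nhds]
    intro t₀ ht₀
    have hz : V (θ (t₀.1, p)) ≠ 0 := by
      -- a vector field has no zero on a non-trivial orbit
      intro hz
      have hconst : ∀ s, θ (s, θ (t₀.1, p)) = θ (t₀.1, p) := fun s ↦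
        (eq_flow_of_isMIntegralCurve hV1 hθV hθ0 (isMIntegralCurve_const hz) s).symm
      have hp0 : θ (t₀.1, p) = p := by
        have h := hconst (-t₀.1)
        rw [hθadd, neg_add_cancel, hθ0] at h
        exact h.symm
      exact hp (hp0 ▸ hz)
    have hmem : 𝒪 ∈ 𝓝 (θ (t₀.1, p)) := h𝒪.mem_nhds (hJ𝒪 t₀.1 t₀.2)
    have hA := eventually_mfderiv_flow_apply_eq_of_eventually hV
      (Filter.eventually_of_mem hmem hW) (Filter.eventually_of_mem hmem hVW) hθV hθ0 hz
    have hT : Tendsto (fun s : J ↦ s.1 - t₀.1) (𝓝 t₀) (𝓝 0) := by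
      have h : Tendsto (fun s : J ↦ s.1 - t₀.1) (𝓝 t₀) (𝓝 (t₀.1 - t₀.1)) :=
        (continuous_subtype_val.tendsto t₀).sub tendsto_const_nhds
      rwa [sub_self] at h
    filter_upwards [hT.eventually hA] with s hs
    have ht₀' : mfderiv 𝓘(ℝ, E) 𝓘(ℝ, E) (fun q ↦ θ (t₀.1, q)) p (W p) = W (θ (t₀.1, p)) := ht₀
    show mfderiv 𝓘(ℝ, E) 𝓘(ℝ, E) (fun q ↦ θ (s.1, q)) p (W p) = W (θ (s.1, p))
    have hfun : (fun q ↦ θ (s.1, q)) = (fun q ↦ θ (s.1 - t₀.1, q)) ∘ (fun q ↦ θ (t₀.1, q)) := by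
      funext q
      simp [hθadd]
    have hd1 := PseudoRiemannianMetric.mdifferentiableAt_flow hθ (s.1 - t₀.1) (θ (t₀.1, p))
    have hd2 := PseudoRiemannianMetric.mdifferentiableAt_flow hθ t₀.1 p
    rw [hfun, mfderiv_comp p hd1 hd2]
    change mfderiv 𝓘(ℝ, E) 𝓘(ℝ, E) (fun q ↦ θ (s.1 - t₀.1, q)) (θ (t₀.1, p))
      (mfderiv 𝓘(ℝ, E) 𝓘(ℝ, E) (fun q ↦ θ (t₀.1, q)) p (W p)) = W (θ (s.1, p))
    rw [ht₀', hs, hθadd, sub_add_cancel]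
  · -- `0 ∈ S`: `θ_0 = id`
    show mfderiv 𝓘(ℝ, E) 𝓘(ℝ, E) (fun q ↦ θ (0, q)) p (W p) = W (θ (0, p))
    have hid : (fun q ↦ θ (0, q)) = id := funext hθ0
    rw [hid, mfderiv_id]
    change W p = W (θ (0, p))
    rw [hθ0]

/-- **Segment form**: under the hypotheses of `mfderiv_flow_apply_eq_of_forall_mem`, if the orbit
segment `θ(s, p)`, `s` between `0` and `t`, lies in the open set `𝒪` on which `W` is `C^∞` and
`[V, W] = 0`, then `dθₜ (W p) = W (θₜ p)`. Lee 2012, Thm. 9.42 (localised to the segment).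
[cite: LeeSmoothManifolds2013, Thm. 9.42] -/
theorem mfderiv_flow_apply_eq_of_forall_uIcc_mem
    (hV : ContMDiff 𝓘(ℝ, E) 𝓘(ℝ, E).tangent ∞ (fun x ↦ (⟨x, V x⟩ : TangentBundle 𝓘(ℝ, E) M)))
    {𝒪 : Set M} (h𝒪 : IsOpen 𝒪)
    (hW : ∀ x ∈ 𝒪,
      ContMDiffAt 𝓘(ℝ, E) 𝓘(ℝ, E).tangent ∞ (fun x ↦ (⟨x, W x⟩ : TangentBundle 𝓘(ℝ, E) M)) x)
    (hVW : ∀ x ∈ 𝒪, mlieBracket 𝓘(ℝ, E) V W x = 0)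
    (hθ : ContMDiff (𝓘(ℝ, ℝ).prod 𝓘(ℝ, E)) 𝓘(ℝ, E) 2 θ)
    (hθV : ∀ p, IsMIntegralCurve (fun t ↦ θ (t, p)) V) (hθ0 : ∀ p, θ (0, p) = p)
    (hθadd : ∀ t s p, θ (t, θ (s, p)) = θ (t + s, p)) {p : M} (hp : V p ≠ 0) {t : ℝ}
    (hseg : ∀ s ∈ uIcc 0 t, θ (s, p) ∈ 𝒪) :
    mfderiv 𝓘(ℝ, E) 𝓘(ℝ, E) (fun q ↦ θ (t, q)) p (W p) = W (θ (t, p)) :=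
  mfderiv_flow_apply_eq_of_forall_mem hV h𝒪 hW hVW hθ hθV hθ0 hθadd hp isPreconnected_uIcc
    left_mem_uIcc hseg right_mem_uIcc

end Literature.Geometry.Lorentzian

end
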